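import Mathlib
import Summits.AnomalousDissipation.AnomalousDissipation.Theses.PointSink
import Summits.AnomalousDissipation.AnomalousDissipation.Theorems.PointSinkPointFluxConeReplicateTools
import Literature.Analysis.FluidPDE.StationaryEulerAlignedCubes
import HarnessLib

/-!
# Stub `stub_replicate` — dilation replication of the wild box
(crux `PointSink.PointFluxCone`, stmt-AnomalousDissipation-19033, line `Sketch`)

`WILDBOX → PointFluxCone`.  The hypothesis is ONE bounded measurable weak Euler pair `(W, P)` on
`ℝ³` supported in the unit box `(0,1)³` (weak Euler with explicit pressure and weakly divergence
free against all smooth compactly supported tests) whose log-radial Bernoulli moment about `-c`,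
`c = 3e₀`, is non-zero.  With `λ = 8` and the measurable selector `k(y) = ⌊log₈ ‖y‖⌋` put
`V(y) = (8^{k(y)})^{-2/3} W(-c + 8^{-k(y)} y)`, `Q(y) = (8^{k(y)})^{-4/3} P(-c + 8^{-k(y)} y)`:
this is the dilation orbit `Σ_{j ∈ ℤ} 8^{-2j/3} W(8^{-j} y − c)` of the translated box
`c + (0,1)³ ⊂ {3 < ‖y‖ < √18}`, of which at most the copy `j = k(y)` is non-zero at `y`
(`replicate_floor_eq`).  Then (tools file `PointSinkPointFluxConeReplicateTools`):
* `V`, `Q` are measurable and exactly discretely self-similar of degrees `(-2/3, -4/3)` (the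
  selector shifts by one under `y ↦ 8y`);
* they are bounded on every exterior region `‖y‖ ≥ r > 0`, hence locally integrable off `0`;
* a test field supported off the origin meets finitely many shells `k = j`, the tested Euler /
  divergence integrand is the finite sum of the rescaled translated pieces, and each piece
  integrates to zero by scaling covariance of the hypothesis (`replicate_piece`);
* on the fundamental shell `1 < ‖y‖ < 8` the selector vanishes, `(V, Q)(y) = (W, P)(y - c)`, and
  the flux integral is the translated box moment, non-zero by hypothesis.

References: A. Choffrut, L. Székelyhidi Jr., SIAM J. Math. Anal. 46 (2014) (the wild box);
the replication itself is folklore scaling covariance of the stationary Euler system.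
-/

noncomputable section

open scoped InnerProductSpace ContDiff ENNReal Topology
open Set Function MeasureTheory Metric Filter
open Literature.Analysis.FluidPDE Literature.Analysis.FluidPDE.StationaryEuler
open Literature.Analysis.FunctionSpaces

set_option linter.dupNamespace false

namespace Summit.AnomalousDissipation.AnomalousDissipation.Theorems

/-- **Measurability of the replicated field** `y ↦ (8^{k(y)})^s F(-c + 8^{-k(y)} y)` for a
measurable selector `k` and a measurable `F`. [folklore] -/
theorem replicate_measurable {G : Type*} [NormedAddCommGroup G] [NormedSpace ℝ G]
    [MeasurableSpace G] [BorelSpace G] [SecondCountableTopology G] {F : Ed (Fin 3) → G}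
    (hF : Measurable F) (s : ℝ) {k : Ed (Fin 3) → ℤ} (hk : Measurable k) :
    Measurable fun y => ((8 : ℝ) ^ k y) ^ s •
      F (-((3 : ℝ) • eb (0 : Fin 3)) + ((8 : ℝ) ^ k y)⁻¹ • y) := by
  have ha : Measurable fun y => (8 : ℝ) ^ k y :=
    (measurable_of_countable fun j : ℤ => (8 : ℝ) ^ j).comp hk
  exact (ha.pow_const s).smul (hF.comp ((ha.inv.smul measurable_id).const_add _))

/-- **Discrete self-similarity of the replicated field**: if the selector shifts by one under
`y ↦ 8y`, then `V(8y) = 8^s V(y)` for `V(y) = (8^{k(y)})^s F(-c + 8^{-k(y)} y)`. [folklore] -/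
theorem replicate_dss {G : Type*} [NormedAddCommGroup G] [NormedSpace ℝ G] (F : Ed (Fin 3) → G)
    (s : ℝ) (k : Ed (Fin 3) → ℤ) (hk1 : ∀ y, y ≠ 0 → k ((8 : ℝ) • y) = k y + 1) {y : Ed (Fin 3)}
    (hy : y ≠ 0) :
    ((8 : ℝ) ^ k ((8 : ℝ) • y)) ^ s •
        F (-((3 : ℝ) • eb (0 : Fin 3)) + ((8 : ℝ) ^ k ((8 : ℝ) • y))⁻¹ • ((8 : ℝ) • y)) =
      (8 : ℝ) ^ s • (((8 : ℝ) ^ k y) ^ s • F (-((3 : ℝ) • eb (0 : Fin 3)) + ((8 : ℝ) ^ k y)⁻¹ • y)) := by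
  have ha : (0 : ℝ) < (8 : ℝ) ^ k y := zpow_pos (by norm_num) _
  rw [hk1 y hy, zpow_add_one₀ (by norm_num : (8 : ℝ) ≠ 0), mul_inv_rev, smul_smul,
    mul_right_comm, inv_mul_cancel₀ (by norm_num : (8 : ℝ) ≠ 0), one_mul,
    Real.mul_rpow ha.le (by norm_num : (0 : ℝ) ≤ 8), smul_smul, mul_comm]

/-- **The replicated field is a weak Euler solution off the origin** (tested against one test field
`φ` supported off `0` whose support meets the shells `k⁻¹(S)` only): the tested integrand is the
finite sum over `j ∈ S` of the rescaled translated pieces, each of which integrates to zero by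
scaling covariance (`replicate_piece`). [folklore] -/
theorem replicate_weakEuler {W : Ed (Fin 3) → Ed (Fin 3)} {P : Ed (Fin 3) → ℝ} {M : ℝ}
    (hWm : Measurable W) (hPm : Measurable P) (hb : ∀ x, ‖W x‖ ≤ M ∧ |P x| ≤ M)
    (hS : ∀ x, x ∉ box (Fin 3) → W x = 0 ∧ P x = 0)
    (hE : ∀ φ : Ed (Fin 3) → Ed (Fin 3), ContDiff ℝ ∞ φ → HasCompactSupport φ →
      ∫ x, (⟪W x, fderiv ℝ φ x (W x)⟫_ℝ + P x * VectorCalculus.divergence φ x) = 0)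
    (k : Ed (Fin 3) → ℤ)
    (hk : ∀ (y : Ed (Fin 3)) (j : ℤ),
      -((3 : ℝ) • eb (0 : Fin 3)) + ((8 : ℝ) ^ j)⁻¹ • y ∈ box (Fin 3) → k y = j)
    {φ : Ed (Fin 3) → Ed (Fin 3)} (hφ : IsTestFunctionOn ⟨{x : Ed (Fin 3) | x ≠ 0}, isOpen_ne⟩ φ)
    {S : Finset ℤ} (hkS : ∀ y ∈ tsupport φ, k y ∈ S) :
    ∫ y, (⟪((8 : ℝ) ^ k y) ^ (-(2 / 3 : ℝ)) • W (-((3 : ℝ) • eb (0 : Fin 3)) + ((8 : ℝ) ^ k y)⁻¹ • y),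
        fderiv ℝ φ y (((8 : ℝ) ^ k y) ^ (-(2 / 3 : ℝ)) •
          W (-((3 : ℝ) • eb (0 : Fin 3)) + ((8 : ℝ) ^ k y)⁻¹ • y))⟫_ℝ +
      ((8 : ℝ) ^ k y) ^ (-(4 / 3 : ℝ)) * P (-((3 : ℝ) • eb (0 : Fin 3)) + ((8 : ℝ) ^ k y)⁻¹ • y) *
        VectorCalculus.divergence φ y) = 0 := by
  refine replicate_integral_eq_zero_of_pieces k S _
    (fun j y => ((8 : ℝ) ^ j) ^ (-(4 / 3 : ℝ)) *
      (⟪W (-((3 : ℝ) • eb (0 : Fin 3)) + ((8 : ℝ) ^ j)⁻¹ • y),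
          fderiv ℝ φ y (W (-((3 : ℝ) • eb (0 : Fin 3)) + ((8 : ℝ) ^ j)⁻¹ • y))⟫_ℝ +
        P (-((3 : ℝ) • eb (0 : Fin 3)) + ((8 : ℝ) ^ j)⁻¹ • y) * VectorCalculus.divergence φ y))
    (fun y => ?_) (fun y j hj => ?_) (fun y hy => ?_) (fun j => ?_) (fun j => ?_)
  · have ha : (0 : ℝ) < (8 : ℝ) ^ k y := zpow_pos (by norm_num) _
    have h2 : ((8 : ℝ) ^ k y) ^ (-(2 / 3 : ℝ)) * ((8 : ℝ) ^ k y) ^ (-(2 / 3 : ℝ)) =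
        ((8 : ℝ) ^ k y) ^ (-(4 / 3 : ℝ)) := by
      rw [← Real.rpow_add ha]; norm_num
    rw [real_inner_smul_left, map_smul, real_inner_smul_right, ← mul_assoc, h2]
    ring
  · obtain ⟨hW0, hP0⟩ := hS _ fun h => hj (hk y j h).symm
    simp [hW0, hP0]
  · have hy' : y ∉ tsupport φ := fun h => hy (hkS y h)
    simp [VectorCalculus.divergence, fderiv_of_notMem_tsupport ℝ hy']
  · exact (replicate_integrable_euler hWm hPm hb hφ.contDiff hφ.hasCompactSupport _ _).const_mul _
  · rw [integral_const_mul]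
    refine mul_eq_zero_of_right _ (replicate_piece (F := Ed (Fin 3))
      (fun L w p => ⟪w, L w⟫_ℝ + p * LinearMap.trace ℝ _ (L : Ed (Fin 3) →ₗ[ℝ] Ed (Fin 3)))
      (fun t L w p => ?_) W P hE (zpow_pos (by norm_num) j) _ hφ.contDiff hφ.hasCompactSupport)
    simp only [smul_apply, real_inner_smul_right, ContinuousLinearMap.toLinearMap_smul,
      map_smul, smul_eq_mul]
    ring

/-- **The replicated field is weakly divergence free off the origin** (same mechanism, pieces
`Dθ(y) W(-c + 8^{-j}y)`). [folklore] -/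
theorem replicate_weakDiv {W : Ed (Fin 3) → Ed (Fin 3)} {M : ℝ} (hWm : Measurable W)
    (hbW : ∀ x, ‖W x‖ ≤ M) (hSW : ∀ x, x ∉ box (Fin 3) → W x = 0)
    (hD : ∀ θ : Ed (Fin 3) → ℝ, ContDiff ℝ ∞ θ → HasCompactSupport θ →
      ∫ x, ⟪W x, gradient θ x⟫_ℝ = 0)
    (k : Ed (Fin 3) → ℤ)
    (hk : ∀ (y : Ed (Fin 3)) (j : ℤ),
      -((3 : ℝ) • eb (0 : Fin 3)) + ((8 : ℝ) ^ j)⁻¹ • y ∈ box (Fin 3) → k y = j)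
    {θ : Ed (Fin 3) → ℝ} (hθ : IsTestFunctionOn ⟨{x : Ed (Fin 3) | x ≠ 0}, isOpen_ne⟩ θ)
    {S : Finset ℤ} (hkS : ∀ y ∈ tsupport θ, k y ∈ S) :
    ∫ y, ⟪((8 : ℝ) ^ k y) ^ (-(2 / 3 : ℝ)) • W (-((3 : ℝ) • eb (0 : Fin 3)) + ((8 : ℝ) ^ k y)⁻¹ • y),
      gradient θ y⟫_ℝ = 0 := by
  have hD' : ∀ ψ : Ed (Fin 3) → ℝ, ContDiff ℝ ∞ ψ → HasCompactSupport ψ →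
      ∫ x, fderiv ℝ ψ x (W x) = 0 := fun ψ h1 h2 => by
    simpa only [replicate_inner_gradient] using hD ψ h1 h2
  simp_rw [real_inner_smul_left, replicate_inner_gradient]
  refine replicate_integral_eq_zero_of_pieces k S _
    (fun j y => ((8 : ℝ) ^ j) ^ (-(2 / 3 : ℝ)) *
      fderiv ℝ θ y (W (-((3 : ℝ) • eb (0 : Fin 3)) + ((8 : ℝ) ^ j)⁻¹ • y)))
    (fun y => rfl) (fun y j hj => ?_) (fun y hy => ?_) (fun j => ?_) (fun j => ?_)
  · simp [hSW _ fun h => hj (hk y j h).symm]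
  · simp [fderiv_of_notMem_tsupport ℝ fun h => hy (hkS y h)]
  · exact (replicate_integrable_grad hWm hbW hθ.contDiff hθ.hasCompactSupport _ _).const_mul _
  · rw [integral_const_mul]
    exact mul_eq_zero_of_right _ (replicate_piece (F := ℝ) (fun L w _ => L w)
      (fun t L w p => by simp) W (fun _ => 0) hD' (zpow_pos (by norm_num) j) _ hθ.contDiff
      hθ.hasCompactSupport)

/-- **The flux over the fundamental shell.** On `1 < ‖y‖ < 8` the selector vanishes, so the
replicated pair is the translated box pair `(W, P)(-c + y)`; the flux density vanishes off the
translated box, and translating back gives the box moment of the hypothesis, which is non-zero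
(in particular integrable). [folklore] -/
theorem replicate_flux {W : Ed (Fin 3) → Ed (Fin 3)} {P : Ed (Fin 3) → ℝ}
    (hS : ∀ x, x ∉ box (Fin 3) → W x = 0 ∧ P x = 0)
    (hmom : (∫ x, (‖W x‖ ^ 2 / 2 + P x) *
      (⟪W x, x + (3 : ℝ) • eb (0 : Fin 3)⟫_ℝ / ‖x + (3 : ℝ) • eb (0 : Fin 3)‖ ^ 2)) ≠ 0)
    (k : Ed (Fin 3) → ℤ) (hk0 : ∀ y, 1 < ‖y‖ → ‖y‖ < 8 → k y = 0) :
    IntegrableOn (fun y => (‖((8 : ℝ) ^ k y) ^ (-(2 / 3 : ℝ)) •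
        W (-((3 : ℝ) • eb (0 : Fin 3)) + ((8 : ℝ) ^ k y)⁻¹ • y)‖ ^ 2 / 2 +
        ((8 : ℝ) ^ k y) ^ (-(4 / 3 : ℝ)) * P (-((3 : ℝ) • eb (0 : Fin 3)) + ((8 : ℝ) ^ k y)⁻¹ • y)) *
        (⟪((8 : ℝ) ^ k y) ^ (-(2 / 3 : ℝ)) • W (-((3 : ℝ) • eb (0 : Fin 3)) + ((8 : ℝ) ^ k y)⁻¹ • y),
          y⟫_ℝ / ‖y‖ ^ 2)) {y | 1 < ‖y‖ ∧ ‖y‖ < 8} volume ∧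
    (∫ y in {y : Ed (Fin 3) | 1 < ‖y‖ ∧ ‖y‖ < 8}, (‖((8 : ℝ) ^ k y) ^ (-(2 / 3 : ℝ)) •
        W (-((3 : ℝ) • eb (0 : Fin 3)) + ((8 : ℝ) ^ k y)⁻¹ • y)‖ ^ 2 / 2 +
        ((8 : ℝ) ^ k y) ^ (-(4 / 3 : ℝ)) * P (-((3 : ℝ) • eb (0 : Fin 3)) + ((8 : ℝ) ^ k y)⁻¹ • y)) *
        (⟪((8 : ℝ) ^ k y) ^ (-(2 / 3 : ℝ)) • W (-((3 : ℝ) • eb (0 : Fin 3)) + ((8 : ℝ) ^ k y)⁻¹ • y),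
          y⟫_ℝ / ‖y‖ ^ 2)) ≠ 0 := by
  set c : Ed (Fin 3) := (3 : ℝ) • eb (0 : Fin 3) with hc
  set m : Ed (Fin 3) → ℝ := fun x => (‖W x‖ ^ 2 / 2 + P x) * (⟪W x, x + c⟫_ℝ / ‖x + c‖ ^ 2)
    with hm
  have hmi : Integrable m := by
    by_contra h
    exact hmom (integral_undef h)
  have hs : MeasurableSet {y : Ed (Fin 3) | 1 < ‖y‖ ∧ ‖y‖ < 8} :=
    (isOpen_Ioo.preimage continuous_norm).measurableSet
  have heq : EqOn (fun y => (‖((8 : ℝ) ^ k y) ^ (-(2 / 3 : ℝ)) • W (-c + ((8 : ℝ) ^ k y)⁻¹ • y)‖ ^ 2 / 2 +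
        ((8 : ℝ) ^ k y) ^ (-(4 / 3 : ℝ)) * P (-c + ((8 : ℝ) ^ k y)⁻¹ • y)) *
        (⟪((8 : ℝ) ^ k y) ^ (-(2 / 3 : ℝ)) • W (-c + ((8 : ℝ) ^ k y)⁻¹ • y), y⟫_ℝ / ‖y‖ ^ 2))
      (fun y => m (-c + y)) {y | 1 < ‖y‖ ∧ ‖y‖ < 8} := fun y hy => by
    simp only [hk0 y hy.1 hy.2, zpow_zero, Real.one_rpow, inv_one, one_smul, one_mul, hm,
      neg_add_cancel_comm]
  have hzero : ∀ y, y ∉ {y : Ed (Fin 3) | 1 < ‖y‖ ∧ ‖y‖ < 8} → m (-c + y) = 0 := fun y hy => by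
    have hW0 : W (-c + y) = 0 := (hS _ fun h => hy (replicate_shell_of_mem_box h)).1
    simp [hm, hW0]
  have hint : Integrable fun y => m (-c + y) := hmi.comp_add_left (-c)
  refine ⟨hint.integrableOn.congr_fun heq.symm hs, ?_⟩
  rw [setIntegral_congr_fun hs heq, setIntegral_eq_integral_of_forall_compl_eq_zero hzero,
    integral_add_left_eq_self m (-c)]
  exact hmom

/-- **WILDBOX → `PointFluxCone` (dilation replication).** With `λ = 8` and `c = 3e₀` (so that
`c + [0,1]³ ⊂ {3 ≤ |y| ≤ √18} ⊂ {1 < |y| < 8}`), put `k(y) = ⌊log₈ |y|⌋`,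
`V(y) = 8^{-2k(y)/3} W(8^{-k(y)}y − c)`, `P(y) = 8^{-4k(y)/3} P_W(8^{-k(y)}y − c)` (the single
copy of the dilation orbit `Σ_k 8^{-2k/3} W(8^{-k}y − c)` that can be non-zero at `y`):
measurable, exactly discretely self-similar (the selector shifts by one), locally bounded hence
locally integrable off `0`; every test supported off `0` meets finitely many shells and each
rescaled translated copy is a weak Euler pair (`y = 8^k(x + c)`, `ψ(x) = φ(8^k(x+c))`), so `V` is
weak Euler and weakly divergence free off the origin; on `{1 < |y| < 8}` only the copy `k = 0` is
present and the flux integral is the translated box moment `≠ 0`. [folklore] -/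
theorem stub_replicate :
    (∃ (W : Ed (Fin 3) → Ed (Fin 3)) (P : Ed (Fin 3) → ℝ) (M : ℝ), Measurable W ∧ Measurable P ∧
      (∀ x, ‖W x‖ ≤ M ∧ |P x| ≤ M) ∧
      (∀ x, x ∉ box (Fin 3) → W x = 0 ∧ P x = 0) ∧
      (∀ φ : Ed (Fin 3) → Ed (Fin 3), ContDiff ℝ ∞ φ → HasCompactSupport φ →
        ∫ x, (⟪W x, fderiv ℝ φ x (W x)⟫_ℝ + P x * VectorCalculus.divergence φ x) = 0) ∧
      (∀ θ : Ed (Fin 3) → ℝ, ContDiff ℝ ∞ θ → HasCompactSupport θ →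
        ∫ x, ⟪W x, gradient θ x⟫_ℝ = 0) ∧
      (∫ x, (‖W x‖ ^ 2 / 2 + P x) *
          (⟪W x, x + (3 : ℝ) • eb (0 : Fin 3)⟫_ℝ / ‖x + (3 : ℝ) • eb (0 : Fin 3)‖ ^ 2)) ≠ 0) →
    Summit.AnomalousDissipation.AnomalousDissipation.Theses.PointSink.PointFluxCone := by
  rintro ⟨W, P, M, hWm, hPm, hb, hS, hE, hD, hmom⟩
  have hbW : ∀ x, ‖W x‖ ≤ M := fun x => (hb x).1
  have hbP : ∀ x, ‖P x‖ ≤ M := fun x => by rw [Real.norm_eq_abs]; exact (hb x).2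
  have hSW : ∀ x, x ∉ box (Fin 3) → W x = 0 := fun x hx => (hS x hx).1
  have hSP : ∀ x, x ∉ box (Fin 3) → P x = 0 := fun x hx => (hS x hx).2
  have hk : ∀ (y : Ed (Fin 3)) (j : ℤ),
      -((3 : ℝ) • eb (0 : Fin 3)) + ((8 : ℝ) ^ j)⁻¹ • y ∈ box (Fin 3) → ⌊Real.logb 8 ‖y‖⌋ = j :=
    fun y j h => replicate_floor_eq h
  have hk1 : ∀ y : Ed (Fin 3), y ≠ 0 → ⌊Real.logb 8 ‖(8 : ℝ) • y‖⌋ = ⌊Real.logb 8 ‖y‖⌋ + 1 :=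
    fun y hy => replicate_floor_smul hy
  have hVm := replicate_measurable hWm (-(2 / 3 : ℝ)) replicate_measurable_floor
  have hQm := replicate_measurable hPm (-(4 / 3 : ℝ)) replicate_measurable_floor
  obtain ⟨h9, h10⟩ := replicate_flux hS hmom (fun y => ⌊Real.logb 8 ‖y‖⌋)
    fun y h1 h8 => replicate_floor_shell h1 h8
  unfold Summit.AnomalousDissipation.AnomalousDissipation.Theses.PointSink.PointFluxCone
  refine ⟨8, fun y => ((8 : ℝ) ^ ⌊Real.logb 8 ‖y‖⌋) ^ (-(2 / 3 : ℝ)) •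
      W (-((3 : ℝ) • eb (0 : Fin 3)) + ((8 : ℝ) ^ ⌊Real.logb 8 ‖y‖⌋)⁻¹ • y),
    fun y => ((8 : ℝ) ^ ⌊Real.logb 8 ‖y‖⌋) ^ (-(4 / 3 : ℝ)) *
      P (-((3 : ℝ) • eb (0 : Fin 3)) + ((8 : ℝ) ^ ⌊Real.logb 8 ‖y‖⌋)⁻¹ • y),
    by norm_num, hVm.aestronglyMeasurable, fun y hy => ?_, fun y hy => ?_, ?_, ?_,
    fun φ hφ => ?_, fun θ hθ => ?_, h9, h10⟩
  · -- discrete self-similarity of `V`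
    exact replicate_dss W _ (fun y => ⌊Real.logb 8 ‖y‖⌋) hk1 hy
  · -- discrete self-similarity of the pressure
    simpa only [smul_eq_mul] using
      replicate_dss P (-(4 / 3 : ℝ)) (fun y => ⌊Real.logb 8 ‖y‖⌋) hk1 hy
  · -- local integrability of `‖V‖²` off the origin
    refine replicate_locallyIntegrableOn (hVm.norm.pow_const 2).aestronglyMeasurable
      fun r hr => ⟨((r / 8) ^ (-(2 / 3 : ℝ)) * M) ^ 2, fun y hy => ?_⟩
    rw [norm_pow, norm_norm]
    exact pow_le_pow_left₀ (norm_nonneg _)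
      (replicate_norm_piece_le hbW hSW (by norm_num) hr (zpow_pos (by norm_num) _) hy) 2
  · -- local integrability of the pressure off the origin
    refine replicate_locallyIntegrableOn
      (by simpa only [smul_eq_mul] using hQm.aestronglyMeasurable)
      fun r hr => ⟨(r / 8) ^ (-(4 / 3 : ℝ)) * M, fun y hy => ?_⟩
    simpa only [smul_eq_mul] using replicate_norm_piece_le (G := ℝ) hbP hSP (by norm_num) hr
      (zpow_pos (by norm_num) ⌊Real.logb 8 ‖y‖⌋) hy
  · -- weak Euler with pressure off the origin
    obtain ⟨S, hkS⟩ := replicate_exists_finset hφ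
    exact replicate_weakEuler hWm hPm hb hS hE _ hk hφ hkS
  · -- weakly divergence free off the origin
    obtain ⟨S, hkS⟩ := replicate_exists_finset hθ
    exact replicate_weakDiv hWm hbW hSW hD _ hk hθ hkS

end Summit.AnomalousDissipation.AnomalousDissipation.Theorems

end
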